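import Literature.Probability.RandomPlanarGeometry.HexSAWBrickWallStripFugacityWidthOneContactModerateDeviations
import HarnessLib

/-!
# Moderate deviations of the contact number, LOWER bound: `P_{N,y,z}(bc ≥ Nb + x_N√N) ≥ exp(−(1+η)x_N²/(2σ²))` and the full MDP limit

Topic `Literature/Probability/RandomPlanarGeometry` (continues `…WidthOneContactModerateDeviations.lean`: ★★★ `abs_log_contactMGF_sub_le` (the log-mgf expansion
`|log M̃_N(s) − σ²s²/2| ≤ ηs² + η` UNIFORM in `|s| ≤ δ√N`, `M̃_N(s) = C_{1,N}(ye^{s/√N},z)/C_{1,N}(y,z)·e^{−s√N b}`) and the moderate-deviation UPPER bounds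
`P_N(bc ≷ Nb ± x_N√N) ≤ e^{−(1−η)x_N²/(2σ²)}`).  THIS FILE proves the matching LOWER bound by the Cramér change of measure at the moderate tilt
`s_N = (1+δ)x_N/σ²` — the tilted measure is `P_{N, ye^{s_N/√N}, z}` itself, so its tails are again controlled by `abs_log_contactMGF_sub_le` (two exponential
Chebyshev bounds UNDER the tilt), with no variance estimate needed:

* §1 (finite sums) `sum_contacts_ge_mul_rpow_le'` / `sum_contacts_le_mul_rpow_le'` (Chernoff at a real threshold), ★★ `window_lower_bound`:
  for `U, V ≥ 1`, `0 < W ≤ 1`, `A ≤ A'`: `U^{A'}·Σ_{bc ≥ A} wgt ≥ C_{1,N}(yU,z) − C_{1,N}(yUV,z)/V^{A'} − C_{1,N}(yUW,z)/W^{A}` (restrict to the window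
  `A ≤ bc ≤ A'`, undo the tilt there, and remove the two tails of the tilted measure by Chernoff).
  `window_lower_bound_down` (the same for a downward tilt `0 < U ≤ 1` and the event `bc ≤ A'`).
* §2 ★★★ `eventually_contactUpperTail_ge_exp_moderate` / ★★★ `eventually_contactLowerTail_ge_exp_moderate`: for `x_N → ∞`, `x_N/√N → 0` and every
  `η > 0`, for all large `N`, `P_{N,y,z}(bc ≥ N·b + x_N√N) ≥ exp(−(1+η)·x_N²/(2σ²))` and `P_{N,y,z}(bc ≤ N·b − x_N√N) ≥ exp(−(1+η)·x_N²/(2σ²))`.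
* §3 ★★★ `tendsto_log_contactUpperTail_div_sq` / `tendsto_log_contactLowerTail_div_sq`: `x_N^{−2}·log P_{N,y,z}(bc ≷ Nb ± x_N√N) → −1/(2σ²)` —
  THE MODERATE DEVIATION PRINCIPLE for both tails at every scale `√N ≪ x_N√N ≪ N` (with the upper bounds of the parent file).

## Sources
A. Dembo, O. Zeitouni, *Large Deviations Techniques and Applications* (2010) §2.3 (Gärtner–Ellis lower bound: change of measure + upper bound for the tilted
law) and §3.7 (moderate deviations); lane statements.  N. R. Beaton et al., CMP 326 (2014), arXiv:1109.0358v5 §3.2 Proposition 6 (p. 10).  Nothing is quoted AS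
PRINTED.
-/

noncomputable section

open Filter Topology Finset Set Literature.Analysis
open Literature.Probability.LatticeModels Literature.Probability.Percolation

namespace Literature.Probability.RandomPlanarGeometry.SAW.HexBW

namespace WidthOneYZ

variable {y z : ℝ}

/-! ## §1 The change-of-measure lower bound for a window (finite sums) -/

open Classical in
/-- Chernoff at a real threshold, upper side: for `u ≥ 1`, `(Σ_{bc ≥ A} wgt)·u^{A} ≤ C_{1,N}(yu, z)`.
[cite: DemboZeitouni2010, §2.3 (exponential Chebyshev; lane plumbing)] -/
theorem sum_contacts_ge_mul_rpow_le' (hy : 0 ≤ y) (hz : 0 ≤ z) {u : ℝ} (hu : 1 ≤ u) (N : ℕ) (A : ℝ) :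
    (∑ q ∈ (stripPairs 1 N).filter (fun q => A ≤ (bottomVisits₀ q.1 q.2 N : ℝ)), wgt y z N q) * u ^ A ≤ stripZ₂ 1 N (y * u) z := by
  have hu0 : 0 ≤ u := zero_le_one.trans hu
  rw [Finset.sum_mul, stripZ₂_one_eq_sum_wgt]
  calc ∑ q ∈ (stripPairs 1 N).filter (fun q => A ≤ (bottomVisits₀ q.1 q.2 N : ℝ)), wgt y z N q * u ^ A
      ≤ ∑ q ∈ (stripPairs 1 N).filter (fun q => A ≤ (bottomVisits₀ q.1 q.2 N : ℝ)), wgt (y * u) z N q :=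
        Finset.sum_le_sum fun q hq => by
          rw [wgt_tilt]
          refine mul_le_mul_of_nonneg_left ?_ (wgt_nonneg hy hz N q)
          calc u ^ A ≤ u ^ ((bottomVisits₀ q.1 q.2 N : ℕ) : ℝ) := Real.rpow_le_rpow_of_exponent_le hu (Finset.mem_filter.1 hq).2
            _ = u ^ bottomVisits₀ q.1 q.2 N := Real.rpow_natCast u _
    _ ≤ ∑ q ∈ stripPairs 1 N, wgt (y * u) z N q :=
        Finset.sum_le_sum_of_subset_of_nonneg (Finset.filter_subset _ _) fun q _ _ => wgt_nonneg (mul_nonneg hy hu0) hz N q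

open Classical in
/-- Chernoff at a real threshold, lower side: for `0 < u ≤ 1`, `(Σ_{bc ≤ A} wgt)·u^{A} ≤ C_{1,N}(yu, z)`.
[cite: DemboZeitouni2010, §2.3 (exponential Chebyshev; lane plumbing)] -/
theorem sum_contacts_le_mul_rpow_le' (hy : 0 ≤ y) (hz : 0 ≤ z) {u : ℝ} (hu0 : 0 < u) (hu1 : u ≤ 1) (N : ℕ) (A : ℝ) :
    (∑ q ∈ (stripPairs 1 N).filter (fun q => (bottomVisits₀ q.1 q.2 N : ℝ) ≤ A), wgt y z N q) * u ^ A ≤ stripZ₂ 1 N (y * u) z := by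
  rw [Finset.sum_mul, stripZ₂_one_eq_sum_wgt]
  calc ∑ q ∈ (stripPairs 1 N).filter (fun q => (bottomVisits₀ q.1 q.2 N : ℝ) ≤ A), wgt y z N q * u ^ A
      ≤ ∑ q ∈ (stripPairs 1 N).filter (fun q => (bottomVisits₀ q.1 q.2 N : ℝ) ≤ A), wgt (y * u) z N q :=
        Finset.sum_le_sum fun q hq => by
          rw [wgt_tilt]
          refine mul_le_mul_of_nonneg_left ?_ (wgt_nonneg hy hz N q)
          calc u ^ A ≤ u ^ ((bottomVisits₀ q.1 q.2 N : ℕ) : ℝ) :=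
                Real.rpow_le_rpow_of_exponent_ge hu0 hu1 (Finset.mem_filter.1 hq).2
            _ = u ^ bottomVisits₀ q.1 q.2 N := Real.rpow_natCast u _
    _ ≤ ∑ q ∈ stripPairs 1 N, wgt (y * u) z N q :=
        Finset.sum_le_sum_of_subset_of_nonneg (Finset.filter_subset _ _) fun q _ _ => wgt_nonneg (mul_nonneg hy hu0.le) hz N q

open Classical in
/-- ★★ **THE WINDOW LOWER BOUND (Cramér's change of measure, finite sums).**  For `y, z ≥ 0`, `U ≥ 1`, `V ≥ 1`, `0 < W ≤ 1` and reals `A, A'`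
(of interest for `A ≤ A'`):
`U^{A'} · Σ_{bc ≥ A} y^{bc}z^{tc} ≥ C_{1,N}(yU,z) − C_{1,N}(yUV,z)/V^{A'} − C_{1,N}(yUW,z)/W^{A}` — restrict to the window `A ≤ bc ≤ A'`, where
`y^{bc} ≥ (yU)^{bc}·U^{−A'}`, and bound the tilted weights outside the window by the two Chernoff inequalities for the TILTED fugacity `yU`.
[cite: DemboZeitouni2010, §2.3 (proof of the Gärtner–Ellis lower bound: change of measure; lane statement)] -/
theorem window_lower_bound (hy : 0 ≤ y) (hz : 0 ≤ z) {U V W : ℝ} (hU : 1 ≤ U) (hV : 1 ≤ V) (hW0 : 0 < W) (hW1 : W ≤ 1) (N : ℕ)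
    (A A' : ℝ) :
    stripZ₂ 1 N (y * U) z - stripZ₂ 1 N (y * U * V) z / V ^ A' - stripZ₂ 1 N (y * U * W) z / W ^ A
      ≤ U ^ A' * ∑ q ∈ (stripPairs 1 N).filter (fun q => A ≤ (bottomVisits₀ q.1 q.2 N : ℝ)), wgt y z N q := by
  have hU0 : 0 < U := lt_of_lt_of_le one_pos hU
  have hV0 : 0 < V := lt_of_lt_of_le one_pos hV
  have hyU : 0 ≤ y * U := mul_nonneg hy hU0.le
  set S := stripPairs 1 N with hS
  set B : Site 2 × (ℕ → Site 2) → ℝ := fun q => (bottomVisits₀ q.1 q.2 N : ℝ) with hB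
  set f : Site 2 × (ℕ → Site 2) → ℝ := fun q => wgt (y * U) z N q with hf
  have hf0 : ∀ q, 0 ≤ f q := fun q => wgt_nonneg hyU hz N q
  -- the two tails of the tilted weights
  have hR : ∑ q ∈ S.filter (fun q => A' ≤ B q), f q ≤ stripZ₂ 1 N (y * U * V) z / V ^ A' := by
    rw [le_div_iff₀ (Real.rpow_pos_of_pos hV0 _)]
    exact sum_contacts_ge_mul_rpow_le' hyU hz hV N A'
  have hL : ∑ q ∈ S.filter (fun q => B q ≤ A), f q ≤ stripZ₂ 1 N (y * U * W) z / W ^ A := by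
    rw [le_div_iff₀ (Real.rpow_pos_of_pos hW0 _)]
    exact sum_contacts_le_mul_rpow_le' hyU hz hW0 hW1 N A
  -- the whole tilted mass splits into window + two tails
  have hsplit : stripZ₂ 1 N (y * U) z ≤ ∑ q ∈ S.filter (fun q => A ≤ B q ∧ B q ≤ A'), f q
      + ∑ q ∈ S.filter (fun q => B q ≤ A), f q + ∑ q ∈ S.filter (fun q => A' ≤ B q), f q := by
    rw [stripZ₂_one_eq_sum_wgt, Finset.sum_filter, Finset.sum_filter, Finset.sum_filter, ← Finset.sum_add_distrib, ← Finset.sum_add_distrib]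
    refine Finset.sum_le_sum fun q _ => ?_
    have h0 := hf0 q
    have i1 : 0 ≤ (if A ≤ B q ∧ B q ≤ A' then f q else 0) := by split_ifs <;> linarith
    have i2 : 0 ≤ (if B q ≤ A then f q else 0) := by split_ifs <;> linarith
    have i3 : 0 ≤ (if A' ≤ B q then f q else 0) := by split_ifs <;> linarith
    by_cases h3 : B q ≤ A
    · rw [if_pos h3]; linarith
    · by_cases h4 : A' ≤ B q
      · rw [if_pos h4]; linarith
      · have hw : A ≤ B q ∧ B q ≤ A' := ⟨(not_le.1 h3).le, (not_le.1 h4).le⟩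
        rw [if_pos hw]; linarith
  -- on the window, undo the tilt: `wgt(yU) = wgt·U^{bc} ≤ wgt·U^{A'}`
  have hwin : ∑ q ∈ S.filter (fun q => A ≤ B q ∧ B q ≤ A'), f q ≤ U ^ A' * ∑ q ∈ S.filter (fun q => A ≤ B q), wgt y z N q := by
    rw [Finset.mul_sum]
    calc ∑ q ∈ S.filter (fun q => A ≤ B q ∧ B q ≤ A'), f q
        ≤ ∑ q ∈ S.filter (fun q => A ≤ B q ∧ B q ≤ A'), U ^ A' * wgt y z N q :=
          Finset.sum_le_sum fun q hq => by
            obtain ⟨-, -, h2⟩ := Finset.mem_filter.1 hq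
            rw [hf]
            show wgt (y * U) z N q ≤ U ^ A' * wgt y z N q
            rw [wgt_tilt, mul_comm]
            refine mul_le_mul_of_nonneg_right ?_ (wgt_nonneg hy hz N q)
            calc U ^ bottomVisits₀ q.1 q.2 N = U ^ ((bottomVisits₀ q.1 q.2 N : ℕ) : ℝ) := (Real.rpow_natCast U _).symm
              _ ≤ U ^ A' := Real.rpow_le_rpow_of_exponent_le hU h2
      _ ≤ ∑ q ∈ S.filter (fun q => A ≤ B q), U ^ A' * wgt y z N q :=
          Finset.sum_le_sum_of_subset_of_nonneg (fun q hq => by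
            obtain ⟨hqS, h1, -⟩ := Finset.mem_filter.1 hq
            exact Finset.mem_filter.2 ⟨hqS, h1⟩) fun q _ _ => mul_nonneg (Real.rpow_nonneg hU0.le _) (wgt_nonneg hy hz N q)
  linarith


open Classical in
/-- ★★ **THE WINDOW LOWER BOUND, DOWNWARD TILT** (`0 < U ≤ 1`): for reals `A, A'` (of interest for `A ≤ A'`),
`U^{A} · Σ_{bc ≤ A'} y^{bc}z^{tc} ≥ C_{1,N}(yU,z) − C_{1,N}(yUV,z)/V^{A'} − C_{1,N}(yUW,z)/W^{A}` (`V ≥ 1`, `0 < W ≤ 1`).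
[cite: DemboZeitouni2010, §2.3 (change of measure; lane statement)] -/
theorem window_lower_bound_down (hy : 0 ≤ y) (hz : 0 ≤ z) {U V W : ℝ} (hU0 : 0 < U) (hU1 : U ≤ 1) (hV : 1 ≤ V) (hW0 : 0 < W)
    (hW1 : W ≤ 1) (N : ℕ) (A A' : ℝ) :
    stripZ₂ 1 N (y * U) z - stripZ₂ 1 N (y * U * V) z / V ^ A' - stripZ₂ 1 N (y * U * W) z / W ^ A
      ≤ U ^ A * ∑ q ∈ (stripPairs 1 N).filter (fun q => (bottomVisits₀ q.1 q.2 N : ℝ) ≤ A'), wgt y z N q := by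
  have hV0 : 0 < V := lt_of_lt_of_le one_pos hV
  have hyU : 0 ≤ y * U := mul_nonneg hy hU0.le
  set S := stripPairs 1 N with hS
  set B : Site 2 × (ℕ → Site 2) → ℝ := fun q => (bottomVisits₀ q.1 q.2 N : ℝ) with hB
  set f : Site 2 × (ℕ → Site 2) → ℝ := fun q => wgt (y * U) z N q with hf
  have hf0 : ∀ q, 0 ≤ f q := fun q => wgt_nonneg hyU hz N q
  have hR : ∑ q ∈ S.filter (fun q => A' ≤ B q), f q ≤ stripZ₂ 1 N (y * U * V) z / V ^ A' := by
    rw [le_div_iff₀ (Real.rpow_pos_of_pos hV0 _)]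
    exact sum_contacts_ge_mul_rpow_le' hyU hz hV N A'
  have hL : ∑ q ∈ S.filter (fun q => B q ≤ A), f q ≤ stripZ₂ 1 N (y * U * W) z / W ^ A := by
    rw [le_div_iff₀ (Real.rpow_pos_of_pos hW0 _)]
    exact sum_contacts_le_mul_rpow_le' hyU hz hW0 hW1 N A
  have hsplit : stripZ₂ 1 N (y * U) z ≤ ∑ q ∈ S.filter (fun q => A ≤ B q ∧ B q ≤ A'), f q
      + ∑ q ∈ S.filter (fun q => B q ≤ A), f q + ∑ q ∈ S.filter (fun q => A' ≤ B q), f q := by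
    rw [stripZ₂_one_eq_sum_wgt, Finset.sum_filter, Finset.sum_filter, Finset.sum_filter, ← Finset.sum_add_distrib, ← Finset.sum_add_distrib]
    refine Finset.sum_le_sum fun q _ => ?_
    have h0 := hf0 q
    have i1 : 0 ≤ (if A ≤ B q ∧ B q ≤ A' then f q else 0) := by split_ifs <;> linarith
    have i2 : 0 ≤ (if B q ≤ A then f q else 0) := by split_ifs <;> linarith
    have i3 : 0 ≤ (if A' ≤ B q then f q else 0) := by split_ifs <;> linarith
    by_cases h3 : B q ≤ A
    · rw [if_pos h3]; linarith
    · by_cases h4 : A' ≤ B q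
      · rw [if_pos h4]; linarith
      · have hw : A ≤ B q ∧ B q ≤ A' := ⟨(not_le.1 h3).le, (not_le.1 h4).le⟩
        rw [if_pos hw]; linarith
  -- on the window, undo the DOWNWARD tilt: `wgt(yU) = wgt·U^{bc} ≤ wgt·U^{A}` (`U ≤ 1`, `bc ≥ A`)
  have hwin : ∑ q ∈ S.filter (fun q => A ≤ B q ∧ B q ≤ A'), f q ≤ U ^ A * ∑ q ∈ S.filter (fun q => B q ≤ A'), wgt y z N q := by
    rw [Finset.mul_sum]
    calc ∑ q ∈ S.filter (fun q => A ≤ B q ∧ B q ≤ A'), f q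
        ≤ ∑ q ∈ S.filter (fun q => A ≤ B q ∧ B q ≤ A'), U ^ A * wgt y z N q :=
          Finset.sum_le_sum fun q hq => by
            obtain ⟨-, h1, -⟩ := Finset.mem_filter.1 hq
            rw [hf]
            show wgt (y * U) z N q ≤ U ^ A * wgt y z N q
            rw [wgt_tilt, mul_comm]
            refine mul_le_mul_of_nonneg_right ?_ (wgt_nonneg hy hz N q)
            calc U ^ bottomVisits₀ q.1 q.2 N = U ^ ((bottomVisits₀ q.1 q.2 N : ℕ) : ℝ) := (Real.rpow_natCast U _).symm
              _ ≤ U ^ A := Real.rpow_le_rpow_of_exponent_ge hU0 hU1 h1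
      _ ≤ ∑ q ∈ S.filter (fun q => B q ≤ A'), U ^ A * wgt y z N q :=
          Finset.sum_le_sum_of_subset_of_nonneg (fun q hq => by
            obtain ⟨hqS, -, h2⟩ := Finset.mem_filter.1 hq
            exact Finset.mem_filter.2 ⟨hqS, h2⟩) fun q _ _ => mul_nonneg (Real.rpow_nonneg hU0.le _) (wgt_nonneg hy hz N q)
  linarith

/-! ## §2 ★★★ The moderate-deviation lower bound -/

/-- The variance rate is positive (plumbing copy). [cite: DemboZeitouni2010, §2.3 (lane plumbing)] -/
private theorem deriv_contactB_exp_pos₄ (hy : 0 < y) (hz : 0 < z) : 0 < deriv (fun A => contactB (Real.exp A) z) (Real.log y) := by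
  have h := hasDerivAt_contactB_log (Real.log y) (Real.log z)
  simp only [Real.exp_log hy, Real.exp_log hz] at h
  obtain ⟨-, -, dA, -, -, hpos, -⟩ := h
  rw [dA.deriv]
  exact hpos

/-- Algebra of the exponents (plumbing): the main term. [cite: DemboZeitouni2010, §2.3 (lane plumbing)] -/
private theorem mdp_alg_main (σ δ X : ℝ) (hσ : σ ≠ 0) :
    -((1 + δ) * X / σ * ((1 + 2 * δ) * X)) + σ * ((1 + δ) * X / σ) ^ 2 / 2 = -((1 + δ) * (1 + 3 * δ)) * (X ^ 2 / (2 * σ)) := by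
  field_simp; ring

/-- Algebra of the exponents (plumbing): the upper tilted tail. [cite: DemboZeitouni2010, §2.3 (lane plumbing)] -/
private theorem mdp_alg_up (σ δ X : ℝ) (hσ : σ ≠ 0) :
    σ * ((1 + δ) * X / σ + δ * X / σ) ^ 2 / 2 - σ * ((1 + δ) * X / σ) ^ 2 / 2 - δ * X / σ * ((1 + 2 * δ) * X)
      = -(δ ^ 2 * X ^ 2 / σ) / 2 := by
  field_simp; ring

/-- Algebra of the exponents (plumbing): the lower tilted tail. [cite: DemboZeitouni2010, §2.3 (lane plumbing)] -/
private theorem mdp_alg_down (σ δ X : ℝ) (hσ : σ ≠ 0) :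
    σ * ((1 + δ) * X / σ - δ * X / σ) ^ 2 / 2 - σ * ((1 + δ) * X / σ) ^ 2 / 2 + δ * X / σ * X = -(δ ^ 2 * X ^ 2 / σ) / 2 := by
  field_simp; ring

/-- Algebra (plumbing): the three `η₁`-terms in units of `Q = δ²X²/σ`. [cite: DemboZeitouni2010, §2.3 (lane plumbing)] -/
private theorem mdp_alg_eta (σ δ X : ℝ) (hσ : σ ≠ 0) :
    δ ^ 2 * σ / 20 * ((1 + δ) * X / σ + δ * X / σ) ^ 2 = (1 + 2 * δ) ^ 2 / 20 * (δ ^ 2 * X ^ 2 / σ) ∧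
    δ ^ 2 * σ / 20 * ((1 + δ) * X / σ) ^ 2 = (1 + δ) ^ 2 / 20 * (δ ^ 2 * X ^ 2 / σ) ∧
    δ ^ 2 * σ / 20 * ((1 + δ) * X / σ - δ * X / σ) ^ 2 = 1 / 20 * (δ ^ 2 * X ^ 2 / σ) := by
  refine ⟨?_, ?_, ?_⟩ <;> field_simp <;> ring

open Classical in
/-- ★★★ **MODERATE DEVIATIONS, UPPER TAIL, LOWER BOUND WITH THE GAUSSIAN RATE.**  For all `y, z > 0`, every sequence `x_N → ∞` with `x_N/√N → 0`
and every `η > 0`, for all large `N`: `P_{N,y,z}(bc ≥ N·b + x_N√N) ≥ exp(−(1+η)·x_N²/(2σ²))`, `σ² = d/dA b(e^A,z)|_{log y}`.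
Proof: the window lower bound at the tilt `U = e^{s₁/√N}`, `s₁ = (1+δ₀)x_N/σ²`, window `[Nb + x_N√N, Nb + (1+2δ₀)x_N√N]`, `V = e^{λ/√N}`, `W = e^{−λ/√N}`,
`λ = δ₀x_N/σ²`: all `√N b`-terms cancel and the parent's uniform expansion `|log M̃_N(s) − σ²s²/2| ≤ η₁s² + η₁` at `s ∈ {s₁, s₁ ± λ}` (admissible:
`O(x_N) ≤ δ√N`) shows that the two tilted tails are `≤ M̃_N(s₁)/4` and that `log(M̃_N(s₁)e^{−s₁(1+2δ₀)x_N}) ≥ −(1+δ₀)(1+3δ₀)x_N²/(2σ²) − o(x_N²)`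
(`δ₀ = min(η,1)/10`, `η₁ = δ₀²σ²/20`).
[cite: DemboZeitouni2010, §2.3 (Gärtner–Ellis lower bound by change of measure) and §3.7 (moderate deviations); lane statement] -/
theorem eventually_contactUpperTail_ge_exp_moderate (hy : 0 < y) (hz : 0 < z) {x : ℕ → ℝ} (hx : Tendsto x atTop atTop)
    (hxN : Tendsto (fun N => x N / Real.sqrt N) atTop (𝓝 0)) {η : ℝ} (hη : 0 < η) :
    ∀ᶠ N : ℕ in atTop,
      Real.exp (-((1 + η) * x N ^ 2 / (2 * deriv (fun A => contactB (Real.exp A) z) (Real.log y)))) ≤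
        (∑ q ∈ (stripPairs 1 N).filter (fun q => (N : ℝ) * contactB y z + x N * Real.sqrt N ≤ (bottomVisits₀ q.1 q.2 N : ℝ)), wgt y z N q)
          / stripZ₂ 1 N y z := by
  set σ2 := deriv (fun A => contactB (Real.exp A) z) (Real.log y) with hσ2
  set b := contactB y z with hb
  have hσ : 0 < σ2 := deriv_contactB_exp_pos₄ hy hz
  -- constants
  set θ := min η 1 with hθ
  have hθ0 : 0 < θ := lt_min hη one_pos
  have hθ1 : θ ≤ 1 := min_le_right _ _
  have hθη : θ ≤ η := min_le_left _ _
  set δ₀ := θ / 10 with hδ₀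
  have hδ₀0 : 0 < δ₀ := by positivity
  have hδ₀1 : δ₀ ≤ 1 / 10 := by rw [hδ₀]; linarith
  have hδ₀η : δ₀ ≤ η / 10 := by rw [hδ₀]; linarith
  -- small numeric facts (proved while the context is small)
  have c1 : (1 + 2 * δ₀) ^ 2 / 20 ≤ 2 / 25 := by nlinarith
  have c2 : (1 + δ₀) ^ 2 / 20 ≤ 2 / 25 := by nlinarith
  have hδη : 4 * δ₀ ≤ 2 / 5 * η := by linarith
  have hδsq : (79 / 25 : ℝ) * δ₀ ^ 2 ≤ 1 / 25 * η := by nlinarith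
  set η₁ := δ₀ ^ 2 * σ2 / 20 with hη₁
  have hη₁0 : 0 < η₁ := by positivity
  -- the parent's uniform expansion with `η₁`
  obtain ⟨δ, hδ, hunif⟩ := abs_log_contactMGF_sub_le hy hz hη₁0
  -- eventual conditions on `x_N`
  have hx0 : ∀ᶠ N : ℕ in atTop, 1 ≤ x N := hx.eventually (eventually_ge_atTop 1)
  have hx2 : Tendsto (fun N => x N ^ 2) atTop atTop := (tendsto_pow_atTop two_ne_zero).comp hx
  have hE1 : ∀ᶠ N : ℕ in atTop, 4 * (2 * η₁ + Real.log 4) * σ2 / δ₀ ^ 2 ≤ x N ^ 2 := hx2.eventually (eventually_ge_atTop _)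
  have hE2 : ∀ᶠ N : ℕ in atTop, 4 * σ2 * (Real.log 2 + η₁) / η ≤ x N ^ 2 := hx2.eventually (eventually_ge_atTop _)
  have hxs : ∀ᶠ N : ℕ in atTop, x N / Real.sqrt N ≤ δ * σ2 / 2 := by
    have : (0 : ℝ) < δ * σ2 / 2 := by positivity
    exact (hxN.eventually (Iic_mem_nhds this)).mono fun N hN => hN
  filter_upwards [hunif, hx0, hE1, hE2, hxs, eventually_ge_atTop 1] with N hU hx1 hx21 hx22 hxsN hN1
  have hNr : (0 : ℝ) < N := by exact_mod_cast hN1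
  have hsq : 0 < Real.sqrt (N : ℝ) := Real.sqrt_pos.2 hNr
  have hNN : (N : ℝ) = Real.sqrt N * Real.sqrt N := (Real.mul_self_sqrt hNr.le).symm
  have hxpos : 0 < x N := lt_of_lt_of_le one_pos hx1
  -- tilt parameters
  set s₁ := (1 + δ₀) * x N / σ2 with hs₁
  set lam := δ₀ * x N / σ2 with hlam
  have hs₁0 : 0 < s₁ := by positivity
  have hlam0 : 0 < lam := by positivity
  have hls : lam < s₁ := by rw [hlam, hs₁]; exact div_lt_div_of_pos_right (by nlinarith) hσ
  -- admissibility `|s| ≤ δ√N` for `s ∈ {s₁, s₁ ± λ}` (all in `(0, (1+2δ₀)x/σ²]`)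
  have hadm : ∀ s : ℝ, 0 < s → s ≤ s₁ + lam → |s| ≤ δ * Real.sqrt N := by
    intro s hs0 hsle
    rw [abs_of_pos hs0]
    have h1 : s₁ + lam = (1 + 2 * δ₀) * x N / σ2 := by rw [hs₁, hlam]; ring
    have h2 : (1 + 2 * δ₀) * x N / σ2 ≤ 2 * x N / σ2 :=
      div_le_div_of_nonneg_right (by nlinarith only [hδ₀1, hxpos]) hσ.le
    have h3 : x N ≤ δ * σ2 / 2 * Real.sqrt N := by rwa [div_le_iff₀ hsq] at hxsN
    have h4 : 2 * x N / σ2 ≤ δ * Real.sqrt N := by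
      rw [div_le_iff₀ hσ]; linarith only [h3]
    linarith only [hsle, h1, h2, h4]
  have hA1 := hU s₁ (hadm s₁ hs₁0 (by linarith))
  have hA2 := hU (s₁ + lam) (hadm (s₁ + lam) (by linarith) le_rfl)
  have hA3 := hU (s₁ - lam) (hadm (s₁ - lam) (by linarith) (by linarith))
  -- the normalised mgf `m(s) = C_{1,N}(y e^{s/√N}, z)/C_{1,N}(y,z) · e^{−s√N b}` and its logarithm
  obtain ⟨m, hm⟩ : ∃ m : ℝ → ℝ, ∀ s, m s = stripZ₂ 1 N (y * Real.exp (s / Real.sqrt N)) z / stripZ₂ 1 N y z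
      * Real.exp (-(s * Real.sqrt N * b)) := ⟨fun s => _, fun s => rfl⟩
  have hZ := stripZ₂_pos 1 N hy hz
  have hmpos : ∀ s, 0 < m s := fun s => by
    rw [hm]; exact mul_pos (div_pos (stripZ₂_pos 1 N (mul_pos hy (Real.exp_pos _)) hz) hZ) (Real.exp_pos _)
  rw [← hσ2] at hA1 hA2 hA3
  have hl1 : |Real.log (m s₁) - σ2 * s₁ ^ 2 / 2| ≤ η₁ * s₁ ^ 2 + η₁ := by rw [hm]; exact hA1
  have hl2 : |Real.log (m (s₁ + lam)) - σ2 * (s₁ + lam) ^ 2 / 2| ≤ η₁ * (s₁ + lam) ^ 2 + η₁ := by rw [hm]; exact hA2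
  have hl3 : |Real.log (m (s₁ - lam)) - σ2 * (s₁ - lam) ^ 2 / 2| ≤ η₁ * (s₁ - lam) ^ 2 + η₁ := by rw [hm]; exact hA3
  obtain ⟨hl1a, hl1b⟩ := abs_le.1 hl1
  obtain ⟨-, hl2b⟩ := abs_le.1 hl2
  obtain ⟨-, hl3b⟩ := abs_le.1 hl3
  -- the window lower bound at `U = e^{s₁/√N}`, `V = e^{λ/√N}`, `W = e^{−λ/√N}`
  set U := Real.exp (s₁ / Real.sqrt N) with hUdef
  set V := Real.exp (lam / Real.sqrt N) with hVdef
  set W := Real.exp (-(lam / Real.sqrt N)) with hWdef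
  have hU1 : 1 ≤ U := Real.one_le_exp (div_pos hs₁0 hsq).le
  have hV1 : 1 ≤ V := Real.one_le_exp (div_pos hlam0 hsq).le
  have hW0 : 0 < W := Real.exp_pos _
  have hW1 : W ≤ 1 := Real.exp_le_one_iff.2 (by rw [neg_nonpos]; positivity)
  set x' := (1 + 2 * δ₀) * x N with hx'
  set A := (N : ℝ) * b + x N * Real.sqrt N with hAdef
  set A' := (N : ℝ) * b + x' * Real.sqrt N with hA'def
  have hwin := window_lower_bound hy.le hz.le hU1 hV1 hW0 hW1 N A A'
  -- rewrite the three tilted partition functions and the three powers through `m` and exponentials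
  have hlin : ∀ c e : ℝ, c / Real.sqrt N * ((N : ℝ) * b + e * Real.sqrt N) = c * Real.sqrt N * b + c * e := by
    intro c e
    have hs0 : Real.sqrt (N : ℝ) ≠ 0 := hsq.ne'
    calc c / Real.sqrt N * ((N : ℝ) * b + e * Real.sqrt N)
        = c * ((N : ℝ) / Real.sqrt N) * b + c * e * (Real.sqrt N / Real.sqrt N) := by ring
      _ = c * Real.sqrt N * b + c * e := by rw [Real.div_sqrt, div_self hs0, mul_one]
  have hUA' : U ^ A' = Real.exp (s₁ * Real.sqrt N * b + s₁ * x') := by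
    rw [hUdef, ← Real.exp_mul]; exact congrArg Real.exp (hlin s₁ x')
  have hVA' : V ^ A' = Real.exp (lam * Real.sqrt N * b + lam * x') := by
    rw [hVdef, ← Real.exp_mul]; exact congrArg Real.exp (hlin lam x')
  have hWA : W ^ A = Real.exp (-(lam * Real.sqrt N * b + lam * x N)) := by
    rw [hWdef, ← Real.exp_mul]; exact congrArg Real.exp (by rw [neg_mul, hlin lam (x N)])
  have eUV : y * U * V = y * Real.exp ((s₁ + lam) / Real.sqrt N) := by rw [hUdef, hVdef, mul_assoc, ← Real.exp_add, add_div]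
  have eUW : y * U * W = y * Real.exp ((s₁ - lam) / Real.sqrt N) := by
    rw [hUdef, hWdef, mul_assoc, ← Real.exp_add, sub_div, sub_eq_add_neg]
  have hm' : ∀ s, stripZ₂ 1 N (y * Real.exp (s / Real.sqrt N)) z = stripZ₂ 1 N y z * m s * Real.exp (s * Real.sqrt N * b) := by
    intro s
    rw [hm, mul_assoc, mul_assoc, ← Real.exp_add, neg_add_cancel, Real.exp_zero, mul_one, mul_div_cancel₀ _ hZ.ne']
  have t0 : stripZ₂ 1 N (y * U) z = stripZ₂ 1 N y z * m s₁ * Real.exp (s₁ * Real.sqrt N * b) := by rw [hUdef]; exact hm' s₁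
  have t1 : stripZ₂ 1 N (y * U * V) z = stripZ₂ 1 N y z * m (s₁ + lam) * Real.exp ((s₁ + lam) * Real.sqrt N * b) := by
    rw [eUV]; exact hm' (s₁ + lam)
  have t2 : stripZ₂ 1 N (y * U * W) z = stripZ₂ 1 N y z * m (s₁ - lam) * Real.exp ((s₁ - lam) * Real.sqrt N * b) := by
    rw [eUW]; exact hm' (s₁ - lam)
  -- the clean form: `m(s₁) − m(s₁+λ)e^{−λx'} − m(s₁−λ)e^{λx} ≤ P · e^{s₁x'}`
  set P := (∑ q ∈ (stripPairs 1 N).filter (fun q => A ≤ (bottomVisits₀ q.1 q.2 N : ℝ)), wgt y z N q)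
    / stripZ₂ 1 N y z with hP
  have hclean : m s₁ - m (s₁ + lam) * Real.exp (-(lam * x')) - m (s₁ - lam) * Real.exp (lam * x N) ≤ P * Real.exp (s₁ * x') := by
    have hE0 := Real.exp_pos (s₁ * Real.sqrt N * b)
    rw [t0, t1, t2, hUA', hVA', hWA] at hwin
    have e1 : stripZ₂ 1 N y z * m (s₁ + lam) * Real.exp ((s₁ + lam) * Real.sqrt N * b) / Real.exp (lam * Real.sqrt N * b + lam * x')
        = stripZ₂ 1 N y z * Real.exp (s₁ * Real.sqrt N * b) * (m (s₁ + lam) * Real.exp (-(lam * x'))) := by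
      rw [div_eq_iff (Real.exp_pos _).ne']
      have hexp : Real.exp (s₁ * Real.sqrt N * b) * Real.exp (-(lam * x')) * Real.exp (lam * Real.sqrt N * b + lam * x')
          = Real.exp ((s₁ + lam) * Real.sqrt N * b) := by
        rw [← Real.exp_add, ← Real.exp_add]; exact congrArg Real.exp (by ring)
      rw [← hexp]; ring
    have e2 : stripZ₂ 1 N y z * m (s₁ - lam) * Real.exp ((s₁ - lam) * Real.sqrt N * b) / Real.exp (-(lam * Real.sqrt N * b + lam * x N))
        = stripZ₂ 1 N y z * Real.exp (s₁ * Real.sqrt N * b) * (m (s₁ - lam) * Real.exp (lam * x N)) := by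
      rw [div_eq_iff (Real.exp_pos _).ne']
      have hexp : Real.exp (s₁ * Real.sqrt N * b) * Real.exp (lam * x N) * Real.exp (-(lam * Real.sqrt N * b + lam * x N))
          = Real.exp ((s₁ - lam) * Real.sqrt N * b) := by
        rw [← Real.exp_add, ← Real.exp_add]; exact congrArg Real.exp (by ring)
      rw [← hexp]; ring
    have e3 : Real.exp (s₁ * Real.sqrt N * b + s₁ * x') * ∑ q ∈ (stripPairs 1 N).filter
          (fun q => A ≤ (bottomVisits₀ q.1 q.2 N : ℝ)), wgt y z N q
        = stripZ₂ 1 N y z * Real.exp (s₁ * Real.sqrt N * b) * (P * Real.exp (s₁ * x')) := by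
      rw [hP, Real.exp_add]; field_simp
    rw [e1, e2, e3] at hwin
    have e0 : stripZ₂ 1 N y z * m s₁ * Real.exp (s₁ * Real.sqrt N * b) = stripZ₂ 1 N y z * Real.exp (s₁ * Real.sqrt N * b) * m s₁ := by
      ring
    rw [e0, ← mul_sub, ← mul_sub] at hwin
    exact le_of_mul_le_mul_left hwin (mul_pos hZ hE0)
  -- the three exponent identities
  have id1 : -(s₁ * x') + σ2 * s₁ ^ 2 / 2 = -((1 + δ₀) * (1 + 3 * δ₀)) * (x N ^ 2 / (2 * σ2)) := by
    rw [hs₁, hx']; exact mdp_alg_main σ2 δ₀ (x N) hσ.ne'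
  have id2 : σ2 * (s₁ + lam) ^ 2 / 2 - σ2 * s₁ ^ 2 / 2 - lam * x' = -(δ₀ ^ 2 * x N ^ 2 / σ2) / 2 := by
    rw [hs₁, hlam, hx']; exact mdp_alg_up σ2 δ₀ (x N) hσ.ne'
  have id3 : σ2 * (s₁ - lam) ^ 2 / 2 - σ2 * s₁ ^ 2 / 2 + lam * x N = -(δ₀ ^ 2 * x N ^ 2 / σ2) / 2 := by
    rw [hs₁, hlam]; exact mdp_alg_down σ2 δ₀ (x N) hσ.ne'
  -- sizes of the `η₁`-terms in units of `Q = δ₀² x²/σ²`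
  set Q := δ₀ ^ 2 * x N ^ 2 / σ2 with hQ
  have hQ0 : 0 < Q := by positivity
  obtain ⟨ae1, ae2, ae3⟩ := mdp_alg_eta σ2 δ₀ (x N) hσ.ne'
  have q1 : η₁ * (s₁ + lam) ^ 2 ≤ 2 / 25 * Q := by
    have e : η₁ * (s₁ + lam) ^ 2 = (1 + 2 * δ₀) ^ 2 / 20 * Q := by rw [hη₁, hs₁, hlam, hQ]; exact ae1
    rw [e]
    exact mul_le_mul_of_nonneg_right c1 hQ0.le
  have q2 : η₁ * s₁ ^ 2 ≤ 2 / 25 * Q := by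
    have e : η₁ * s₁ ^ 2 = (1 + δ₀) ^ 2 / 20 * Q := by rw [hη₁, hs₁, hQ]; exact ae2
    rw [e]
    exact mul_le_mul_of_nonneg_right c2 hQ0.le
  have q3 : η₁ * (s₁ - lam) ^ 2 ≤ 2 / 25 * Q := by
    have e : η₁ * (s₁ - lam) ^ 2 = 1 / 20 * Q := by rw [hη₁, hs₁, hlam, hQ]; exact ae3
    rw [e]
    exact mul_le_mul_of_nonneg_right (by norm_num) hQ0.le
  have hQbig : 4 * (2 * η₁ + Real.log 4) ≤ Q := by
    rw [hQ, le_div_iff₀ hσ]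
    have := hx21
    rw [div_le_iff₀ (by positivity : (0 : ℝ) < δ₀ ^ 2)] at this
    linarith only [this]
  have hlog4 : 0 < Real.log 4 := Real.log_pos (by norm_num)
  have hlog2 : 0 < Real.log 2 := Real.log_pos (by norm_num)
  -- the two tilted tails are at most `m(s₁)/4`
  have hquarter : m s₁ / 4 = Real.exp (Real.log (m s₁) - Real.log 4) := by
    rw [Real.exp_sub, Real.exp_log (hmpos s₁), Real.exp_log (by norm_num : (0 : ℝ) < 4)]
  have hT1 : m (s₁ + lam) * Real.exp (-(lam * x')) ≤ m s₁ / 4 := by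
    rw [hquarter, ← Real.exp_log (hmpos (s₁ + lam)), ← Real.exp_add]
    apply Real.exp_le_exp.2
    linarith only [hl2b, hl1a, id2, q1, q2, hQbig, hη₁0.le, hlog4, hQ0.le]
  have hT2 : m (s₁ - lam) * Real.exp (lam * x N) ≤ m s₁ / 4 := by
    rw [hquarter, ← Real.exp_log (hmpos (s₁ - lam)), ← Real.exp_add]
    apply Real.exp_le_exp.2
    linarith only [hl3b, hl1a, id3, q3, q2, hQbig, hη₁0.le, hlog4, hQ0.le]
  -- hence `m(s₁)/2 ≤ P e^{s₁x'}`
  have hhalf : m s₁ / 2 ≤ P * Real.exp (s₁ * x') := by linarith only [hclean, hT1, hT2]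
  -- the main exponent inequality
  set R := x N ^ 2 / (2 * σ2) with hR
  have hR0 : 0 < R := by positivity
  have hQR : Q = 2 * δ₀ ^ 2 * R := by rw [hQ, hR]; field_simp
  have hRη : Real.log 2 + η₁ ≤ R * (η / 2) := by
    have h22 : 4 * σ2 * (Real.log 2 + η₁) ≤ x N ^ 2 * η := (div_le_iff₀ hη).1 hx22
    rw [hR, show x N ^ 2 / (2 * σ2) * (η / 2) = x N ^ 2 * η / (4 * σ2) by ring, le_div_iff₀ (by positivity)]
    linarith only [h22]
  have hmain : -((1 + η) * x N ^ 2 / (2 * σ2)) ≤ Real.log (m s₁) - Real.log 2 - s₁ * x' := by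
    have e : (1 + η) * x N ^ 2 / (2 * σ2) = (1 + η) * R := by rw [hR]; ring
    rw [e]
    have h1 : Real.log (m s₁) - s₁ * x' ≥ -((1 + δ₀) * (1 + 3 * δ₀)) * R - η₁ * s₁ ^ 2 - η₁ := by linarith only [hl1a, id1]
    have h2 : η₁ * s₁ ^ 2 ≤ 4 / 25 * δ₀ ^ 2 * R := by rw [hQR] at q2; linarith only [q2]
    have h3 : R * (4 * δ₀) ≤ R * (2 / 5 * η) := mul_le_mul_of_nonneg_left hδη hR0.le
    have h4 : R * ((79 / 25 : ℝ) * δ₀ ^ 2) ≤ R * (1 / 25 * η) := mul_le_mul_of_nonneg_left hδsq hR0.le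
    have hηR : 0 ≤ η * R := by positivity
    linarith only [h1, h2, h3, h4, hRη, hR0.le, hη.le, hηR]
  -- conclude
  calc Real.exp (-((1 + η) * x N ^ 2 / (2 * σ2)))
      ≤ Real.exp (Real.log (m s₁) - Real.log 2 - s₁ * x') := Real.exp_le_exp.2 hmain
    _ = m s₁ / 2 * Real.exp (-(s₁ * x')) := by
        rw [show Real.log (m s₁) - Real.log 2 - s₁ * x' = (Real.log (m s₁) - Real.log 2) + (-(s₁ * x')) by ring, Real.exp_add,
          Real.exp_sub, Real.exp_log (hmpos s₁), Real.exp_log (by norm_num : (0 : ℝ) < 2)]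
    _ ≤ P := by
        have hE := Real.exp_pos (s₁ * x')
        have hE' := Real.exp_pos (-(s₁ * x'))
        have : m s₁ / 2 * Real.exp (-(s₁ * x')) ≤ P * Real.exp (s₁ * x') * Real.exp (-(s₁ * x')) :=
          mul_le_mul_of_nonneg_right hhalf hE'.le
        rwa [mul_assoc, ← Real.exp_add, add_neg_cancel, Real.exp_zero, mul_one] at this


open Classical in
/-- ★★★ **MODERATE DEVIATIONS, LOWER TAIL, LOWER BOUND WITH THE GAUSSIAN RATE.**  For all `y, z > 0`, every sequence `x_N → ∞` with `x_N/√N → 0`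
and every `η > 0`, for all large `N`: `P_{N,y,z}(bc ≤ N·b − x_N√N) ≥ exp(−(1+η)·x_N²/(2σ²))` (the downward tilt `U = e^{−s₁/√N}`; same constants).
Proof: `window_lower_bound_down` at `U = e^{−s₁/√N}`, window `[Nb − (1+2δ₀)x_N√N, Nb − x_N√N]`, and the parent's expansion at `−s₁, −s₁ ± λ`.
[cite: DemboZeitouni2010, §2.3 (Gärtner–Ellis lower bound by change of measure) and §3.7 (moderate deviations); lane statement] -/
theorem eventually_contactLowerTail_ge_exp_moderate (hy : 0 < y) (hz : 0 < z) {x : ℕ → ℝ} (hx : Tendsto x atTop atTop)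
    (hxN : Tendsto (fun N => x N / Real.sqrt N) atTop (𝓝 0)) {η : ℝ} (hη : 0 < η) :
    ∀ᶠ N : ℕ in atTop,
      Real.exp (-((1 + η) * x N ^ 2 / (2 * deriv (fun A => contactB (Real.exp A) z) (Real.log y)))) ≤
        (∑ q ∈ (stripPairs 1 N).filter (fun q => (bottomVisits₀ q.1 q.2 N : ℝ) ≤ (N : ℝ) * contactB y z - x N * Real.sqrt N), wgt y z N q)
          / stripZ₂ 1 N y z := by
  set σ2 := deriv (fun A => contactB (Real.exp A) z) (Real.log y) with hσ2
  set b := contactB y z with hb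
  have hσ : 0 < σ2 := deriv_contactB_exp_pos₄ hy hz
  -- constants
  set θ := min η 1 with hθ
  have hθ0 : 0 < θ := lt_min hη one_pos
  have hθ1 : θ ≤ 1 := min_le_right _ _
  have hθη : θ ≤ η := min_le_left _ _
  set δ₀ := θ / 10 with hδ₀
  have hδ₀0 : 0 < δ₀ := by positivity
  have hδ₀1 : δ₀ ≤ 1 / 10 := by rw [hδ₀]; linarith
  have hδ₀η : δ₀ ≤ η / 10 := by rw [hδ₀]; linarith
  -- small numeric facts (proved while the context is small)
  have c1 : (1 + 2 * δ₀) ^ 2 / 20 ≤ 2 / 25 := by nlinarith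
  have c2 : (1 + δ₀) ^ 2 / 20 ≤ 2 / 25 := by nlinarith
  have hδη : 4 * δ₀ ≤ 2 / 5 * η := by linarith
  have hδsq : (79 / 25 : ℝ) * δ₀ ^ 2 ≤ 1 / 25 * η := by nlinarith
  set η₁ := δ₀ ^ 2 * σ2 / 20 with hη₁
  have hη₁0 : 0 < η₁ := by positivity
  -- the parent's uniform expansion with `η₁`
  obtain ⟨δ, hδ, hunif⟩ := abs_log_contactMGF_sub_le hy hz hη₁0
  -- eventual conditions on `x_N`
  have hx0 : ∀ᶠ N : ℕ in atTop, 1 ≤ x N := hx.eventually (eventually_ge_atTop 1)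
  have hx2 : Tendsto (fun N => x N ^ 2) atTop atTop := (tendsto_pow_atTop two_ne_zero).comp hx
  have hE1 : ∀ᶠ N : ℕ in atTop, 4 * (2 * η₁ + Real.log 4) * σ2 / δ₀ ^ 2 ≤ x N ^ 2 := hx2.eventually (eventually_ge_atTop _)
  have hE2 : ∀ᶠ N : ℕ in atTop, 4 * σ2 * (Real.log 2 + η₁) / η ≤ x N ^ 2 := hx2.eventually (eventually_ge_atTop _)
  have hxs : ∀ᶠ N : ℕ in atTop, x N / Real.sqrt N ≤ δ * σ2 / 2 := by
    have : (0 : ℝ) < δ * σ2 / 2 := by positivity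
    exact (hxN.eventually (Iic_mem_nhds this)).mono fun N hN => hN
  filter_upwards [hunif, hx0, hE1, hE2, hxs, eventually_ge_atTop 1] with N hU hx1 hx21 hx22 hxsN hN1
  have hNr : (0 : ℝ) < N := by exact_mod_cast hN1
  have hsq : 0 < Real.sqrt (N : ℝ) := Real.sqrt_pos.2 hNr
  have hNN : (N : ℝ) = Real.sqrt N * Real.sqrt N := (Real.mul_self_sqrt hNr.le).symm
  have hxpos : 0 < x N := lt_of_lt_of_le one_pos hx1
  -- tilt parameters
  set s₁ := (1 + δ₀) * x N / σ2 with hs₁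
  set lam := δ₀ * x N / σ2 with hlam
  have hs₁0 : 0 < s₁ := by positivity
  have hlam0 : 0 < lam := by positivity
  have hls : lam < s₁ := by rw [hlam, hs₁]; exact div_lt_div_of_pos_right (by nlinarith) hσ
  -- admissibility `|s| ≤ δ√N` for `s ∈ {s₁, s₁ ± λ}` (all in `(0, (1+2δ₀)x/σ²]`)
  have hadm : ∀ s : ℝ, 0 < s → s ≤ s₁ + lam → |s| ≤ δ * Real.sqrt N := by
    intro s hs0 hsle
    rw [abs_of_pos hs0]
    have h1 : s₁ + lam = (1 + 2 * δ₀) * x N / σ2 := by rw [hs₁, hlam]; ring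
    have h2 : (1 + 2 * δ₀) * x N / σ2 ≤ 2 * x N / σ2 :=
      div_le_div_of_nonneg_right (by nlinarith only [hδ₀1, hxpos]) hσ.le
    have h3 : x N ≤ δ * σ2 / 2 * Real.sqrt N := by rwa [div_le_iff₀ hsq] at hxsN
    have h4 : 2 * x N / σ2 ≤ δ * Real.sqrt N := by
      rw [div_le_iff₀ hσ]; linarith only [h3]
    linarith only [hsle, h1, h2, h4]
  have hadm' : ∀ s : ℝ, 0 < s → s ≤ s₁ + lam → |(-s)| ≤ δ * Real.sqrt N := fun s hs0 hsle => by
    rw [abs_neg]; exact hadm s hs0 hsle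
  have hA1 := hU (-s₁) (hadm' s₁ hs₁0 (by linarith))
  have hA2 := hU (-(s₁ - lam)) (hadm' (s₁ - lam) (by linarith) (by linarith))
  have hA3 := hU (-(s₁ + lam)) (hadm' (s₁ + lam) (by linarith) le_rfl)
  -- the normalised mgf `m(s) = C_{1,N}(y e^{s/√N}, z)/C_{1,N}(y,z) · e^{−s√N b}` and its logarithm
  obtain ⟨m, hm⟩ : ∃ m : ℝ → ℝ, ∀ s, m s = stripZ₂ 1 N (y * Real.exp (s / Real.sqrt N)) z / stripZ₂ 1 N y z
      * Real.exp (-(s * Real.sqrt N * b)) := ⟨fun s => _, fun s => rfl⟩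
  have hZ := stripZ₂_pos 1 N hy hz
  have hmpos : ∀ s, 0 < m s := fun s => by
    rw [hm]; exact mul_pos (div_pos (stripZ₂_pos 1 N (mul_pos hy (Real.exp_pos _)) hz) hZ) (Real.exp_pos _)
  rw [← hσ2] at hA1 hA2 hA3
  have hl1 : |Real.log (m (-s₁)) - σ2 * s₁ ^ 2 / 2| ≤ η₁ * s₁ ^ 2 + η₁ := by rw [hm, ← neg_sq s₁]; exact hA1
  have hl2 : |Real.log (m (-(s₁ - lam))) - σ2 * (s₁ - lam) ^ 2 / 2| ≤ η₁ * (s₁ - lam) ^ 2 + η₁ := by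
    rw [hm, ← neg_sq (s₁ - lam)]; exact hA2
  have hl3 : |Real.log (m (-(s₁ + lam))) - σ2 * (s₁ + lam) ^ 2 / 2| ≤ η₁ * (s₁ + lam) ^ 2 + η₁ := by
    rw [hm, ← neg_sq (s₁ + lam)]; exact hA3
  obtain ⟨hl1a, hl1b⟩ := abs_le.1 hl1
  obtain ⟨-, hl2b⟩ := abs_le.1 hl2
  obtain ⟨-, hl3b⟩ := abs_le.1 hl3
  -- the downward window lower bound at `U = e^{−s₁/√N}`, `V = e^{λ/√N}`, `W = e^{−λ/√N}`
  set U := Real.exp (-(s₁ / Real.sqrt N)) with hUdef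
  set V := Real.exp (lam / Real.sqrt N) with hVdef
  set W := Real.exp (-(lam / Real.sqrt N)) with hWdef
  have hU0 : 0 < U := Real.exp_pos _
  have hU1 : U ≤ 1 := Real.exp_le_one_iff.2 (by rw [neg_nonpos]; positivity)
  have hV1 : 1 ≤ V := Real.one_le_exp (div_pos hlam0 hsq).le
  have hW0 : 0 < W := Real.exp_pos _
  have hW1 : W ≤ 1 := Real.exp_le_one_iff.2 (by rw [neg_nonpos]; positivity)
  set x' := (1 + 2 * δ₀) * x N with hx'
  set A' := (N : ℝ) * b - x N * Real.sqrt N with hA'def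
  set A := (N : ℝ) * b - x' * Real.sqrt N with hAdef
  have hwin := window_lower_bound_down hy.le hz.le hU0 hU1 hV1 hW0 hW1 N A A'
  -- rewrite the three tilted partition functions and the three powers through `m` and exponentials
  have hlin : ∀ c e : ℝ, c / Real.sqrt N * ((N : ℝ) * b - e * Real.sqrt N) = c * Real.sqrt N * b - c * e := by
    intro c e
    have hs0 : Real.sqrt (N : ℝ) ≠ 0 := hsq.ne'
    calc c / Real.sqrt N * ((N : ℝ) * b - e * Real.sqrt N)
        = c * ((N : ℝ) / Real.sqrt N) * b - c * e * (Real.sqrt N / Real.sqrt N) := by ring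
      _ = c * Real.sqrt N * b - c * e := by rw [Real.div_sqrt, div_self hs0, mul_one]
  have hUA' : U ^ A = Real.exp (-(s₁ * Real.sqrt N * b) + s₁ * x') := by
    rw [hUdef, ← Real.exp_mul]; exact congrArg Real.exp (by rw [neg_mul, hlin s₁ x']; ring)
  have hVA' : V ^ A' = Real.exp (lam * Real.sqrt N * b - lam * x N) := by
    rw [hVdef, ← Real.exp_mul]; exact congrArg Real.exp (hlin lam (x N))
  have hWA : W ^ A = Real.exp (-(lam * Real.sqrt N * b - lam * x')) := by
    rw [hWdef, ← Real.exp_mul]; exact congrArg Real.exp (by rw [neg_mul, hlin lam x'])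
  have eUV : y * U * V = y * Real.exp (-(s₁ - lam) / Real.sqrt N) := by
    rw [hUdef, hVdef, mul_assoc, ← Real.exp_add]; congr 2; ring
  have eUW : y * U * W = y * Real.exp (-(s₁ + lam) / Real.sqrt N) := by
    rw [hUdef, hWdef, mul_assoc, ← Real.exp_add]; congr 2; ring
  have hm' : ∀ s, stripZ₂ 1 N (y * Real.exp (s / Real.sqrt N)) z = stripZ₂ 1 N y z * m s * Real.exp (s * Real.sqrt N * b) := by
    intro s
    rw [hm, mul_assoc, mul_assoc, ← Real.exp_add, neg_add_cancel, Real.exp_zero, mul_one, mul_div_cancel₀ _ hZ.ne']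
  have t0 : stripZ₂ 1 N (y * U) z = stripZ₂ 1 N y z * m (-s₁) * Real.exp (-s₁ * Real.sqrt N * b) := by
    rw [hUdef, ← neg_div]; exact hm' (-s₁)
  have t1 : stripZ₂ 1 N (y * U * V) z = stripZ₂ 1 N y z * m (-(s₁ - lam)) * Real.exp (-(s₁ - lam) * Real.sqrt N * b) := by
    rw [eUV]; exact hm' (-(s₁ - lam))
  have t2 : stripZ₂ 1 N (y * U * W) z = stripZ₂ 1 N y z * m (-(s₁ + lam)) * Real.exp (-(s₁ + lam) * Real.sqrt N * b) := by
    rw [eUW]; exact hm' (-(s₁ + lam))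
  -- the clean form: `m(−s₁) − m(−(s₁−λ))e^{λx} − m(−(s₁+λ))e^{−λx'} ≤ P · e^{s₁x'}`
  set P := (∑ q ∈ (stripPairs 1 N).filter (fun q => (bottomVisits₀ q.1 q.2 N : ℝ) ≤ A'), wgt y z N q)
    / stripZ₂ 1 N y z with hP
  have hclean : m (-s₁) - m (-(s₁ + lam)) * Real.exp (-(lam * x')) - m (-(s₁ - lam)) * Real.exp (lam * x N)
      ≤ P * Real.exp (s₁ * x') := by
    have hE0 := Real.exp_pos (-s₁ * Real.sqrt N * b)
    rw [t0, t1, t2, hUA', hVA', hWA] at hwin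
    have e1 : stripZ₂ 1 N y z * m (-(s₁ - lam)) * Real.exp (-(s₁ - lam) * Real.sqrt N * b) / Real.exp (lam * Real.sqrt N * b - lam * x N)
        = stripZ₂ 1 N y z * Real.exp (-s₁ * Real.sqrt N * b) * (m (-(s₁ - lam)) * Real.exp (lam * x N)) := by
      rw [div_eq_iff (Real.exp_pos _).ne']
      have hexp : Real.exp (-s₁ * Real.sqrt N * b) * Real.exp (lam * x N) * Real.exp (lam * Real.sqrt N * b - lam * x N)
          = Real.exp (-(s₁ - lam) * Real.sqrt N * b) := by
        rw [← Real.exp_add, ← Real.exp_add]; exact congrArg Real.exp (by ring)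
      rw [← hexp]; ring
    have e2 : stripZ₂ 1 N y z * m (-(s₁ + lam)) * Real.exp (-(s₁ + lam) * Real.sqrt N * b) / Real.exp (-(lam * Real.sqrt N * b - lam * x'))
        = stripZ₂ 1 N y z * Real.exp (-s₁ * Real.sqrt N * b) * (m (-(s₁ + lam)) * Real.exp (-(lam * x'))) := by
      rw [div_eq_iff (Real.exp_pos _).ne']
      have hexp : Real.exp (-s₁ * Real.sqrt N * b) * Real.exp (-(lam * x')) * Real.exp (-(lam * Real.sqrt N * b - lam * x'))
          = Real.exp (-(s₁ + lam) * Real.sqrt N * b) := by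
        rw [← Real.exp_add, ← Real.exp_add]; exact congrArg Real.exp (by ring)
      rw [← hexp]; ring
    have e3 : Real.exp (-(s₁ * Real.sqrt N * b) + s₁ * x') * ∑ q ∈ (stripPairs 1 N).filter
          (fun q => (bottomVisits₀ q.1 q.2 N : ℝ) ≤ A'), wgt y z N q
        = stripZ₂ 1 N y z * Real.exp (-s₁ * Real.sqrt N * b) * (P * Real.exp (s₁ * x')) := by
      rw [hP, Real.exp_add, neg_mul, neg_mul]; field_simp
    rw [e1, e2, e3] at hwin
    have e0 : stripZ₂ 1 N y z * m (-s₁) * Real.exp (-s₁ * Real.sqrt N * b)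
        = stripZ₂ 1 N y z * Real.exp (-s₁ * Real.sqrt N * b) * m (-s₁) := by ring
    rw [e0, ← mul_sub, ← mul_sub] at hwin
    have hwin' := le_of_mul_le_mul_left hwin (mul_pos hZ hE0)
    linarith only [hwin']
  -- the three exponent identities
  have id1 : -(s₁ * x') + σ2 * s₁ ^ 2 / 2 = -((1 + δ₀) * (1 + 3 * δ₀)) * (x N ^ 2 / (2 * σ2)) := by
    rw [hs₁, hx']; exact mdp_alg_main σ2 δ₀ (x N) hσ.ne'
  have id2 : σ2 * (s₁ + lam) ^ 2 / 2 - σ2 * s₁ ^ 2 / 2 - lam * x' = -(δ₀ ^ 2 * x N ^ 2 / σ2) / 2 := by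
    rw [hs₁, hlam, hx']; exact mdp_alg_up σ2 δ₀ (x N) hσ.ne'
  have id3 : σ2 * (s₁ - lam) ^ 2 / 2 - σ2 * s₁ ^ 2 / 2 + lam * x N = -(δ₀ ^ 2 * x N ^ 2 / σ2) / 2 := by
    rw [hs₁, hlam]; exact mdp_alg_down σ2 δ₀ (x N) hσ.ne'
  -- sizes of the `η₁`-terms in units of `Q = δ₀² x²/σ²`
  set Q := δ₀ ^ 2 * x N ^ 2 / σ2 with hQ
  have hQ0 : 0 < Q := by positivity
  obtain ⟨ae1, ae2, ae3⟩ := mdp_alg_eta σ2 δ₀ (x N) hσ.ne'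
  have q1 : η₁ * (s₁ + lam) ^ 2 ≤ 2 / 25 * Q := by
    have e : η₁ * (s₁ + lam) ^ 2 = (1 + 2 * δ₀) ^ 2 / 20 * Q := by rw [hη₁, hs₁, hlam, hQ]; exact ae1
    rw [e]
    exact mul_le_mul_of_nonneg_right c1 hQ0.le
  have q2 : η₁ * s₁ ^ 2 ≤ 2 / 25 * Q := by
    have e : η₁ * s₁ ^ 2 = (1 + δ₀) ^ 2 / 20 * Q := by rw [hη₁, hs₁, hQ]; exact ae2
    rw [e]
    exact mul_le_mul_of_nonneg_right c2 hQ0.le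
  have q3 : η₁ * (s₁ - lam) ^ 2 ≤ 2 / 25 * Q := by
    have e : η₁ * (s₁ - lam) ^ 2 = 1 / 20 * Q := by rw [hη₁, hs₁, hlam, hQ]; exact ae3
    rw [e]
    exact mul_le_mul_of_nonneg_right (by norm_num) hQ0.le
  have hQbig : 4 * (2 * η₁ + Real.log 4) ≤ Q := by
    rw [hQ, le_div_iff₀ hσ]
    have := hx21
    rw [div_le_iff₀ (by positivity : (0 : ℝ) < δ₀ ^ 2)] at this
    linarith only [this]
  have hlog4 : 0 < Real.log 4 := Real.log_pos (by norm_num)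
  have hlog2 : 0 < Real.log 2 := Real.log_pos (by norm_num)
  -- the two tilted tails are at most `m(s₁)/4`
  have hquarter : m (-s₁) / 4 = Real.exp (Real.log (m (-s₁)) - Real.log 4) := by
    rw [Real.exp_sub, Real.exp_log (hmpos (-s₁)), Real.exp_log (by norm_num : (0 : ℝ) < 4)]
  have hT1 : m (-(s₁ + lam)) * Real.exp (-(lam * x')) ≤ m (-s₁) / 4 := by
    rw [hquarter, ← Real.exp_log (hmpos (-(s₁ + lam))), ← Real.exp_add]
    apply Real.exp_le_exp.2
    linarith only [hl3b, hl1a, id2, q1, q2, hQbig, hη₁0.le, hlog4, hQ0.le]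
  have hT2 : m (-(s₁ - lam)) * Real.exp (lam * x N) ≤ m (-s₁) / 4 := by
    rw [hquarter, ← Real.exp_log (hmpos (-(s₁ - lam))), ← Real.exp_add]
    apply Real.exp_le_exp.2
    linarith only [hl2b, hl1a, id3, q3, q2, hQbig, hη₁0.le, hlog4, hQ0.le]
  -- hence `m(−s₁)/2 ≤ P e^{s₁x'}`
  have hhalf : m (-s₁) / 2 ≤ P * Real.exp (s₁ * x') := by linarith only [hclean, hT1, hT2]
  -- the main exponent inequality
  set R := x N ^ 2 / (2 * σ2) with hR
  have hR0 : 0 < R := by positivity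
  have hQR : Q = 2 * δ₀ ^ 2 * R := by rw [hQ, hR]; field_simp
  have hRη : Real.log 2 + η₁ ≤ R * (η / 2) := by
    have h22 : 4 * σ2 * (Real.log 2 + η₁) ≤ x N ^ 2 * η := (div_le_iff₀ hη).1 hx22
    rw [hR, show x N ^ 2 / (2 * σ2) * (η / 2) = x N ^ 2 * η / (4 * σ2) by ring, le_div_iff₀ (by positivity)]
    linarith only [h22]
  have hmain : -((1 + η) * x N ^ 2 / (2 * σ2)) ≤ Real.log (m (-s₁)) - Real.log 2 - s₁ * x' := by
    have e : (1 + η) * x N ^ 2 / (2 * σ2) = (1 + η) * R := by rw [hR]; ring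
    rw [e]
    have h1 : Real.log (m (-s₁)) - s₁ * x' ≥ -((1 + δ₀) * (1 + 3 * δ₀)) * R - η₁ * s₁ ^ 2 - η₁ := by linarith only [hl1a, id1]
    have h2 : η₁ * s₁ ^ 2 ≤ 4 / 25 * δ₀ ^ 2 * R := by rw [hQR] at q2; linarith only [q2]
    have h3 : R * (4 * δ₀) ≤ R * (2 / 5 * η) := mul_le_mul_of_nonneg_left hδη hR0.le
    have h4 : R * ((79 / 25 : ℝ) * δ₀ ^ 2) ≤ R * (1 / 25 * η) := mul_le_mul_of_nonneg_left hδsq hR0.le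
    have hηR : 0 ≤ η * R := by positivity
    linarith only [h1, h2, h3, h4, hRη, hR0.le, hη.le, hηR]
  -- conclude
  calc Real.exp (-((1 + η) * x N ^ 2 / (2 * σ2)))
      ≤ Real.exp (Real.log (m (-s₁)) - Real.log 2 - s₁ * x') := Real.exp_le_exp.2 hmain
    _ = m (-s₁) / 2 * Real.exp (-(s₁ * x')) := by
        rw [show Real.log (m (-s₁)) - Real.log 2 - s₁ * x' = (Real.log (m (-s₁)) - Real.log 2) + (-(s₁ * x')) by ring, Real.exp_add,
          Real.exp_sub, Real.exp_log (hmpos (-s₁)), Real.exp_log (by norm_num : (0 : ℝ) < 2)]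
    _ ≤ P := by
        have hE := Real.exp_pos (s₁ * x')
        have hE' := Real.exp_pos (-(s₁ * x'))
        have : m (-s₁) / 2 * Real.exp (-(s₁ * x')) ≤ P * Real.exp (s₁ * x') * Real.exp (-(s₁ * x')) :=
          mul_le_mul_of_nonneg_right hhalf hE'.le
        rwa [mul_assoc, ← Real.exp_add, add_neg_cancel, Real.exp_zero, mul_one] at this


/-! ## §3 ★★★ The moderate deviation principle, both tails -/

open Classical in
/-- ★★★ **THE MODERATE DEVIATION PRINCIPLE (upper tails)**: for all `y, z > 0` and every sequence `x_N → ∞` with `x_N/√N → 0`,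
`x_N^{−2} · log P_{N,y,z}(bc ≥ N·b + x_N√N) → −1/(2σ²)`, `σ² = d/dA b(e^A,z)|_{log y}` — the Gaussian rate governs EVERY scale strictly between the
CLT scale `√N` and the large-deviation scale `N` (upper bound: the parent's `eventually_contactUpperTail_le_exp_moderate`; lower bound: §2).
[cite: DemboZeitouni2010, §3.7 (moderate deviations; lane statement) and §2.3 (Gärtner–Ellis)] -/
theorem tendsto_log_contactUpperTail_div_sq (hy : 0 < y) (hz : 0 < z) {x : ℕ → ℝ} (hx : Tendsto x atTop atTop)
    (hxN : Tendsto (fun N => x N / Real.sqrt N) atTop (𝓝 0)) :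
    Tendsto (fun N : ℕ => Real.log ((∑ q ∈ (stripPairs 1 N).filter
        (fun q => (N : ℝ) * contactB y z + x N * Real.sqrt N ≤ (bottomVisits₀ q.1 q.2 N : ℝ)), wgt y z N q) / stripZ₂ 1 N y z) / x N ^ 2)
      atTop (𝓝 (-(1 / (2 * deriv (fun A => contactB (Real.exp A) z) (Real.log y))))) := by
  set σ2 := deriv (fun A => contactB (Real.exp A) z) (Real.log y) with hσ2
  have hσ : 0 < σ2 := deriv_contactB_exp_pos₄ hy hz
  rw [Metric.tendsto_atTop]
  intro ε hε
  -- `η = ε σ²`: then `η/(2σ²) = ε/2`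
  have hη : 0 < ε * σ2 := by positivity
  have hup := eventually_contactUpperTail_le_exp_moderate hy hz hx hxN hη
  have hlo := eventually_contactUpperTail_ge_exp_moderate hy hz hx hxN hη
  have hx1 : ∀ᶠ N : ℕ in atTop, 1 ≤ x N := hx.eventually (eventually_ge_atTop 1)
  obtain ⟨N₀, hN₀⟩ := eventually_atTop.1 ((hup.and hlo).and hx1)
  refine ⟨N₀, fun N hN => ?_⟩
  obtain ⟨⟨hU, hL⟩, hx1N⟩ := hN₀ N hN
  rw [← hσ2] at hU hL
  set P := (∑ q ∈ (stripPairs 1 N).filter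
        (fun q => (N : ℝ) * contactB y z + x N * Real.sqrt N ≤ (bottomVisits₀ q.1 q.2 N : ℝ)), wgt y z N q) / stripZ₂ 1 N y z with hP
  have hPpos : 0 < P := lt_of_lt_of_le (Real.exp_pos _) hL
  have hx2 : 0 < x N ^ 2 := by positivity
  -- `−(1+η)x²/(2σ²) ≤ log P ≤ −(1−η)x²/(2σ²)`
  have h1 : -((1 + ε * σ2) * x N ^ 2 / (2 * σ2)) ≤ Real.log P := by
    have := Real.log_le_log (Real.exp_pos _) hL
    rwa [Real.log_exp] at this
  have h2 : Real.log P ≤ -((1 - ε * σ2) * x N ^ 2 / (2 * σ2)) := by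
    have := Real.log_le_log hPpos hU
    rwa [Real.log_exp] at this
  rw [Real.dist_eq, abs_lt]
  constructor
  · -- lower: log P / x² + 1/(2σ²) > −ε
    have h1' : -((1 + ε * σ2) / (2 * σ2)) ≤ Real.log P / x N ^ 2 := by
      rw [le_div_iff₀ hx2]
      have e : -((1 + ε * σ2) / (2 * σ2)) * x N ^ 2 = -((1 + ε * σ2) * x N ^ 2 / (2 * σ2)) := by ring
      rw [e]; exact h1
    have e2 : -((1 + ε * σ2) / (2 * σ2)) = -(1 / (2 * σ2)) - ε / 2 := by field_simp; ring
    rw [e2] at h1'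
    linarith
  · have h2' : Real.log P / x N ^ 2 ≤ -((1 - ε * σ2) / (2 * σ2)) := by
      rw [div_le_iff₀ hx2]
      have e : -((1 - ε * σ2) / (2 * σ2)) * x N ^ 2 = -((1 - ε * σ2) * x N ^ 2 / (2 * σ2)) := by ring
      rw [e]; exact h2
    have e2 : -((1 - ε * σ2) / (2 * σ2)) = -(1 / (2 * σ2)) + ε / 2 := by field_simp; ring
    rw [e2] at h2'
    linarith

open Classical in
/-- ★★★ **THE MODERATE DEVIATION PRINCIPLE (lower tails)**: for all `y, z > 0` and every sequence `x_N → ∞` with `x_N/√N → 0`,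
`x_N^{−2} · log P_{N,y,z}(bc ≤ N·b − x_N√N) → −1/(2σ²)` (the parent's `eventually_contactLowerTail_le_exp_moderate` and §2's lower-tail bound).
[cite: DemboZeitouni2010, §3.7 (moderate deviations; lane statement) and §2.3 (Gärtner–Ellis)] -/
theorem tendsto_log_contactLowerTail_div_sq (hy : 0 < y) (hz : 0 < z) {x : ℕ → ℝ} (hx : Tendsto x atTop atTop)
    (hxN : Tendsto (fun N => x N / Real.sqrt N) atTop (𝓝 0)) :
    Tendsto (fun N : ℕ => Real.log ((∑ q ∈ (stripPairs 1 N).filter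
        (fun q => (bottomVisits₀ q.1 q.2 N : ℝ) ≤ (N : ℝ) * contactB y z - x N * Real.sqrt N), wgt y z N q) / stripZ₂ 1 N y z) / x N ^ 2)
      atTop (𝓝 (-(1 / (2 * deriv (fun A => contactB (Real.exp A) z) (Real.log y))))) := by
  set σ2 := deriv (fun A => contactB (Real.exp A) z) (Real.log y) with hσ2
  have hσ : 0 < σ2 := deriv_contactB_exp_pos₄ hy hz
  rw [Metric.tendsto_atTop]
  intro ε hε
  -- `η = ε σ²`: then `η/(2σ²) = ε/2`
  have hη : 0 < ε * σ2 := by positivity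
  have hup := eventually_contactLowerTail_le_exp_moderate hy hz hx hxN hη
  have hlo := eventually_contactLowerTail_ge_exp_moderate hy hz hx hxN hη
  have hx1 : ∀ᶠ N : ℕ in atTop, 1 ≤ x N := hx.eventually (eventually_ge_atTop 1)
  obtain ⟨N₀, hN₀⟩ := eventually_atTop.1 ((hup.and hlo).and hx1)
  refine ⟨N₀, fun N hN => ?_⟩
  obtain ⟨⟨hU, hL⟩, hx1N⟩ := hN₀ N hN
  rw [← hσ2] at hU hL
  set P := (∑ q ∈ (stripPairs 1 N).filter
        (fun q => (bottomVisits₀ q.1 q.2 N : ℝ) ≤ (N : ℝ) * contactB y z - x N * Real.sqrt N), wgt y z N q) / stripZ₂ 1 N y z with hP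
  have hPpos : 0 < P := lt_of_lt_of_le (Real.exp_pos _) hL
  have hx2 : 0 < x N ^ 2 := by positivity
  -- `−(1+η)x²/(2σ²) ≤ log P ≤ −(1−η)x²/(2σ²)`
  have h1 : -((1 + ε * σ2) * x N ^ 2 / (2 * σ2)) ≤ Real.log P := by
    have := Real.log_le_log (Real.exp_pos _) hL
    rwa [Real.log_exp] at this
  have h2 : Real.log P ≤ -((1 - ε * σ2) * x N ^ 2 / (2 * σ2)) := by
    have := Real.log_le_log hPpos hU
    rwa [Real.log_exp] at this
  rw [Real.dist_eq, abs_lt]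
  constructor
  · -- lower: log P / x² + 1/(2σ²) > −ε
    have h1' : -((1 + ε * σ2) / (2 * σ2)) ≤ Real.log P / x N ^ 2 := by
      rw [le_div_iff₀ hx2]
      have e : -((1 + ε * σ2) / (2 * σ2)) * x N ^ 2 = -((1 + ε * σ2) * x N ^ 2 / (2 * σ2)) := by ring
      rw [e]; exact h1
    have e2 : -((1 + ε * σ2) / (2 * σ2)) = -(1 / (2 * σ2)) - ε / 2 := by field_simp; ring
    rw [e2] at h1'
    linarith
  · have h2' : Real.log P / x N ^ 2 ≤ -((1 - ε * σ2) / (2 * σ2)) := by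
      rw [div_le_iff₀ hx2]
      have e : -((1 - ε * σ2) / (2 * σ2)) * x N ^ 2 = -((1 - ε * σ2) * x N ^ 2 / (2 * σ2)) := by ring
      rw [e]; exact h2
    have e2 : -((1 - ε * σ2) / (2 * σ2)) = -(1 / (2 * σ2)) + ε / 2 := by field_simp; ring
    rw [e2] at h2'
    linarith

end WidthOneYZ

end Literature.Probability.RandomPlanarGeometry.SAW.HexBW

end
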